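import Summits.BirchSwinnertonDyer.BirchSwinnertonDyer.Theorems.GenusKolyvaginAtTwoEquivariantKolyvaginExactAtTwoKolyvaginPrimeDictionary
import Summits.BirchSwinnertonDyer.BirchSwinnertonDyer.Theorems.GenusKolyvaginAtTwoEquivariantKolyvaginExactAtTwoTwistLocalConditions
import Literature.NumberTheory.EllipticCurves.GoodReductionUnramifiedProofs
import HarnessLib

/-!
# Route `GenusKolyvaginAtTwo`, LINE 6, KEY crux Q3 (inner statement of stmt-BirchSwinnertonDyer-22137):
# the Selmer local condition at a Kolyvagin prime in VISIBLE form — it is read on the restriction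
# `ρ ↦ [res x, ρ]` to `Γ_{K(E[n])}` (fields `mem_loc₁_pl_iff` / `mem_loc₂_pl_iff` of gk2-p2's
# `KolyvaginDescent.VisiblePairHypothesesM`, p632473)

Helper (seat `bsd-line-gk2-p3` g12; `--supports` the crux, closes nothing). In the VISIBLE pair descent
(`Literature/…/HeegnerPointsKolyvaginVisibleDescentPairProofs`) both members' local conditions at a Kolyvagin
prime `ℓ` must factor through ONE group `H` receiving the restrictions `rK₁`, `rK₂` (McCallum 1991 p. 299:
*"the restriction map `H¹(K, E_{p^M}) → H¹(K(E_{p^M}), E_{p^M})`"*): `u ∈ Loc₁ (pl ℓ) ↔ rK₁ u ∈ LocK ℓ`. With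
`H :=` functions `Γ_{K(E_K[n])} → E_K[n]`, `rK₁ u := (ρ ↦ [res u, ρ])`, `rK₂ w := (ρ ↦ [hPsiKT (res w), ρ])`
and `LocK ℓ :=` "vanishes on the inertia group `I_𝔔`" (`𝔔` a prime of `\bar ℤ_K` above the inert `λ ∣ ℓ`),
this file proves exactly those two equivalences, from three facts:

* §1 (any number field `F`, any elliptic `E/F`, good place `v ∤ n`, `𝔓 ∣ v`): `I_𝔓 ≤ Γ_{F(E[n])}`
  (`inertia_le_torsionFixing_of_hasGoodReductionAt`: AEC VII.4.1, tree `smul_geomTorsion_eq_of_mem_inertia`)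
  and **`x ∈ selmerLocalKer_v ⟺ [x, τ] = 0` for all `τ ∈ I_𝔓`** (`mem_selmerLocalKer_iff_forall_h1Eval_eq_zero`:
  the Selmer condition at a good `v ∤ n` is "unramified at `𝔓`", Gross (7.1)/(7.4) = tree
  `selmerLocalKer_eq_unramifiedKer`, and a cocycle is a coboundary on a subgroup acting trivially iff it
  vanishes there);
* §2 (over `ℚ`, `K = ℚ(θ)` quadratic, `v` odd, good, unramified in `K`, `w ∣ v`, `𝔔 ∣ w`): for `x ∈ H¹(ℚ, E[n])`,
  **`x ∈ selmerLocalKer_v(E/ℚ) ⟺ ∀ τ ∈ I_𝔔, [res x, τ] = 0`** (`mem_selmerLocalKer_iff_forall_h1Eval_resTorsion_eq_zero`;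
  transfer `ℚ ⟷ K` by this lineage's `resTorsion_mem_selmerLocalKer` / `mem_selmerLocalKer_of_resTorsion_mem_quadratic`,
  then §1 over `K`), and for the twin `E^{(c)}` and `y ∈ H¹(ℚ, E^{(c)}[n])`,
  **`y ∈ selmerLocalKer_v(E^{(c)}/ℚ) ⟺ ∀ τ ∈ I_𝔔, [hPsiKT (res y), τ] = 0`**
  (`mem_selmerLocalKer_twist_iff_forall_h1Eval_hPsiKT_eq_zero`; additionally through
  `mem_selmerLocalKer_iff_hPsiKT_mem` of `…TwistLocalConditions`), both read in the SAME group
  `Γ_{K(E_K[n])} → E_K[n]`.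

At a Gross–Kolyvagin prime `ℓ` (odd, good for `E` and `E^{(c)}`, `ℓ ∤ c`, inert in `K`) these are the fields
`mem_loc₁_pl_iff`, `mem_loc₂_pl_iff` of the instantiation at `2` (memo VISIBLE-DESCENT-v1 §4 (i), evidence #28 on
the crux). THEOREMS ONLY (no definition, no named fact, no `sorry`, standard axioms). BSD is not proved by any
of this.

References: [McCallumLMS1991] p. 299, §4 Lemma 4.3; [GrossLMS1991] §7 (7.1), (7.4), §9 (pairing after
Prop. 9.1); [SilvermanAEC2009] Prop. VII.4.1, VIII §2, Cor. X.4.4; [SerreGaloisCohomology1997] I §5.1.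
-/

set_option autoImplicit false
set_option linter.dupNamespace false -- tree convention: `Summit.BirchSwinnertonDyer.BirchSwinnertonDyer.Theorems` (summit = sub-problem)

noncomputable section

open scoped Classical

universe u

namespace Summit.BirchSwinnertonDyer.BirchSwinnertonDyer.Theorems.GenusExact.SelmerDescent

open WeierstrassCurve NumberField IsDedekindDomain Field
open Literature.NumberTheory.EllipticCurves Literature.NumberTheory.GaloisRepresentations
open Summit.BirchSwinnertonDyer.BirchSwinnertonDyer.Theorems.GenusExact.EigenClassesFinite

/-! ## §1 Any number field: the Selmer condition at a good `v ∤ n` read on `Γ_{F(E[n])}` -/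

section General

variable {F : Type u} [Field F] [NumberField F] (W : WeierstrassCurve F) [W.IsElliptic]
variable (v : HeightOneSpectrum (𝓞 F))

/-- **Inertia at a good place `v ∤ n` fixes `E[n]`**: `I_𝔓 ≤ Γ_{F(E[n])}` for every prime `𝔓` of `\bar ℤ_F`
above `v` (`E[n]` is unramified at `v`, AEC VII.4.1; the tree's `smul_geomTorsion_eq_of_mem_inertia` in subgroup
form). [cite: SilvermanAEC2009, Prop. VII.4.1] -/
theorem inertia_le_torsionFixing_of_hasGoodReductionAt (hgood : W.HasGoodReductionAt v) {n : ℤ}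
    (hn : (n : 𝓞 F) ∉ v.asIdeal) {𝔓 : Ideal (absIntegers (𝓞 F) F)} (h𝔓 : 𝔓 ∈ v.primesAbove) :
    𝔓.inertia (absoluteGaloisGroup F) ≤ torsionFixing W n := fun _ hτ ↦
  (mem_torsionFixing_iff W n).2 fun P ↦ W.smul_geomTorsion_eq_of_mem_inertia hgood hn h𝔓 hτ P

/-- **The Selmer local condition at a good place `v ∤ n`, read on `Γ_{F(E[n])}`**: for `x ∈ H¹(F, E[n])` and a
prime `𝔓` of `\bar ℤ_F` above `v`, `x ∈ selmerLocalKer_v` iff `[x, τ] = 0` for every `τ ∈ I_𝔓` (the Selmer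
condition is "unramified at `𝔓`" — Gross (7.1)/(7.4), tree `selmerLocalKer_eq_unramifiedKer` —, `I_𝔓` acts
trivially on `E[n]`, and a cocycle is a coboundary on a subgroup acting trivially iff it vanishes there; on
`Γ_{F(E[n])}` the value `[x, τ]` does not depend on the cocycle). [cite: GrossLMS1991, §7 (7.1) and (7.4)]
[cite: SilvermanAEC2009, Cor. X.4.4] [cite: SerreGaloisCohomology1997, I §5.1] -/
theorem mem_selmerLocalKer_iff_forall_h1Eval_eq_zero (hgood : W.HasGoodReductionAt v) {n : ℤ}
    (hn : (n : 𝓞 F) ∉ v.asIdeal) {𝔓 : Ideal (absIntegers (𝓞 F) F)} (h𝔓 : 𝔓 ∈ v.primesAbove)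
    (x : galH1Torsion W n) :
    x ∈ selmerLocalKer W (v.adicCompletion F) n ↔
      ∀ τ ∈ 𝔓.inertia (absoluteGaloisGroup F), h1Eval W n x τ = 0 := by
  have hfix : 𝔓.inertia (absoluteGaloisGroup F) ≤ torsionFixing W n :=
    inertia_le_torsionFixing_of_hasGoodReductionAt W v hgood hn h𝔓
  rw [W.selmerLocalKer_eq_unramifiedKer hgood hn h𝔓]
  obtain ⟨φ, rfl⟩ :=
    oneCocycleClass_surjective (discreteTopRep (absoluteGaloisGroup F) (geomTorsion W n)) x
  rw [unramifiedKer, oneCocycleClass_mem_subgroupResKer_iff]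
  constructor
  · rintro ⟨b, hb⟩ τ hτ
    rw [h1Eval_oneCocycleClass W n φ (hfix hτ), hb ⟨τ, hτ⟩, Subgroup.coe_mk,
      smul_eq_of_mem_torsionFixing W n (hfix hτ) b, sub_self]
  · intro h
    refine ⟨0, fun σ ↦ ?_⟩
    rw [smul_zero, sub_zero, ← h1Eval_oneCocycleClass W n φ (hfix σ.2)]
    exact h σ σ.2

end General

/-! ## §2 Over `ℚ`: both members' Selmer conditions at a place unramified in `K`, read on `Γ_{K(E_K[n])}` -/

section Rat

variable {K : Type} [Field K] [NumberField K] (W : WeierstrassCurve ℚ) [W.IsElliptic]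

/-- **Field `mem_loc₁_pl_iff` (first member).** Let `K = ℚ(θ₀)` be quadratic (`[K : ℚ] = 2`, `θ₀ ∉ ℚ`,
`θ₀² = c₀ ∈ ℤ`), `E = W/ℚ` elliptic, `n : ℤ`, `v` a place of good reduction with `v ∤ 2 c₀ n` (odd, unramified
in `K`), `w ∣ v` a place of `K` and `𝔔` a prime of `\bar ℤ_K` above `w`. Then for `x ∈ H¹(ℚ, E[n])`:
`x ∈ selmerLocalKer_v(E/ℚ) ⟺ [res x, τ] = 0` for every `τ ∈ I_𝔔 ≤ Γ_K` — the Selmer condition at `v` factors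
through `x ↦ (ρ ↦ [res x, ρ])` on `Γ_{K(E_K[n])}`. (Transfer `ℚ ⟷ K` at `v`: `resTorsion_mem_selmerLocalKer`,
`mem_selmerLocalKer_of_resTorsion_mem_quadratic`; then §1 over `K`.) At `2`: `v = ℓ` a Gross–Kolyvagin prime,
`w = λ` inert. [cite: McCallumLMS1991, p. 299 and §4 Lemma 4.3] [cite: GrossLMS1991, §7 (7.1), (7.4)] -/
theorem mem_selmerLocalKer_iff_forall_h1Eval_resTorsion_eq_zero (h2 : Module.finrank ℚ K = 2) {θ₀ : K}
    (hθ₀ : θ₀ ∉ (algebraMap ℚ K).range) {c₀ : ℤ} (hc₀ : θ₀ ^ 2 = algebraMap ℚ K c₀) (n : ℤ)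
    (v : HeightOneSpectrum (𝓞 ℚ)) (w : HeightOneSpectrum (𝓞 K)) [w.asIdeal.LiesOver v.asIdeal]
    (hgood : W.HasGoodReductionAt v) (hn : (n : 𝓞 ℚ) ∉ v.asIdeal) (h2v : (2 : 𝓞 ℚ) ∉ v.asIdeal)
    (hc₀v : ((c₀ : ℤ) : 𝓞 ℚ) ∉ v.asIdeal) {𝔔 : Ideal (absIntegers (𝓞 K) K)} (h𝔔 : 𝔔 ∈ w.primesAbove)
    (x : galH1Torsion W n) :
    x ∈ selmerLocalKer W (v.adicCompletion ℚ) n ↔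
      ∀ τ ∈ 𝔔.inertia (absoluteGaloisGroup K), h1Eval (W.baseChange K) n (resTorsion W K n x) τ = 0 := by
  have hgoodK : (W.baseChange K).HasGoodReductionAt w :=
    hasGoodReductionAt_baseChange_of_hasGoodReductionAt W K v w hgood
  have hnK : (n : 𝓞 K) ∉ w.asIdeal := intCast_notMem_of_liesOver K v w hn
  rw [← mem_selmerLocalKer_iff_forall_h1Eval_eq_zero (W.baseChange K) w hgoodK hnK h𝔔]
  exact ⟨resTorsion_mem_selmerLocalKer W K v w n hgood hn,
    mem_selmerLocalKer_of_resTorsion_mem_quadratic W h2 hθ₀ hc₀ n v w hgood hn h2v hc₀v⟩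

/-- **Field `mem_loc₂_pl_iff` (second member, the twin `E^{(c)}`).** Same field data (`K = ℚ(θ₀)`,
`θ₀² = c₀ ∈ ℤ`, `v ∤ 2 c₀ n`, `w ∣ v`, `𝔔 ∣ w`) and twist data `θ ∉ ℚ`, `θ² = c ∈ ℚ` (so `E^{(c)}_K ≅ E_K`,
`hPsiKT : H¹(K, E^{(c)}_K[n]) ≃ H¹(K, E_K[n])`); `E` and `E^{(c)}` both of good reduction at `v`. Then for
`y ∈ H¹(ℚ, E^{(c)}[n])`: `y ∈ selmerLocalKer_v(E^{(c)}/ℚ) ⟺ [hPsiKT (res y), τ] = 0` for every `τ ∈ I_𝔔` — the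
second member's Selmer condition at `v` factors through `y ↦ (ρ ↦ [hPsiKT (res y), ρ])` into the SAME group
`Γ_{K(E_K[n])} → E_K[n]` as the first member's. (Transfer for `E^{(c)}`, then `mem_selmerLocalKer_iff_hPsiKT_mem`
at `K_w`, then §1 for `E_K`.) [cite: McCallumLMS1991, p. 299 and §4 Lemma 4.3]
[cite: SilvermanAEC2009, X.§4 and X.5 Cor. 5.4] -/
theorem mem_selmerLocalKer_twist_iff_forall_h1Eval_hPsiKT_eq_zero (h2 : Module.finrank ℚ K = 2)
    {θ₀ : K} (hθ₀ : θ₀ ∉ (algebraMap ℚ K).range) {c₀ : ℤ} (hc₀ : θ₀ ^ 2 = algebraMap ℚ K c₀)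
    {θ : K} {c : ℚ} (hθ : θ ∉ Set.range (algebraMap ℚ K)) (hc : θ ^ 2 = algebraMap ℚ K c)
    [(W.quadraticTwist c).IsElliptic] (n : ℤ)
    (v : HeightOneSpectrum (𝓞 ℚ)) (w : HeightOneSpectrum (𝓞 K)) [w.asIdeal.LiesOver v.asIdeal]
    (hgood : W.HasGoodReductionAt v) (hgood' : (W.quadraticTwist c).HasGoodReductionAt v)
    (hn : (n : 𝓞 ℚ) ∉ v.asIdeal) (h2v : (2 : 𝓞 ℚ) ∉ v.asIdeal) (hc₀v : ((c₀ : ℤ) : 𝓞 ℚ) ∉ v.asIdeal)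
    {𝔔 : Ideal (absIntegers (𝓞 K) K)} (h𝔔 : 𝔔 ∈ w.primesAbove)
    (y : galH1Torsion (W.quadraticTwist c) n) :
    y ∈ selmerLocalKer (W.quadraticTwist c) (v.adicCompletion ℚ) n ↔
      ∀ τ ∈ 𝔔.inertia (absoluteGaloisGroup K),
        h1Eval (W.baseChange K) n (hPsiKT W K hθ hc n (resTorsion (W.quadraticTwist c) K n y)) τ = 0 := by
  have hgoodK : (W.baseChange K).HasGoodReductionAt w :=
    hasGoodReductionAt_baseChange_of_hasGoodReductionAt W K v w hgood
  have hnK : (n : 𝓞 K) ∉ w.asIdeal := intCast_notMem_of_liesOver K v w hn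
  rw [← mem_selmerLocalKer_iff_forall_h1Eval_eq_zero (W.baseChange K) w hgoodK hnK h𝔔,
    ← mem_selmerLocalKer_iff_hPsiKT_mem W K hθ hc n (w.adicCompletion K)]
  exact ⟨resTorsion_mem_selmerLocalKer (W.quadraticTwist c) K v w n hgood' hn,
    mem_selmerLocalKer_of_resTorsion_mem_quadratic (W.quadraticTwist c) h2 hθ₀ hc₀ n v w hgood' hn
      h2v hc₀v⟩

end Rat

end Summit.BirchSwinnertonDyer.BirchSwinnertonDyer.Theorems.GenusExact.SelmerDescent

end
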